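import Summits.QuantumFields.YangMills.Theorems.FluctuationComparisonRegPrIntLS2BetaSourceClassesOfBkg
import Summits.QuantumFields.YangMills.Theorems.FluctuationComparisonRegPrIntLS2BetaSourceEnergyLinearShareOfVol
import Summits.QuantumFields.YangMills.Theorems.FluctuationComparisonRegPrIntLS2BetaRowEnergyShareOfVol
import Summits.QuantumFields.YangMills.Theorems.FluctuationComparisonRegPrIntLS2BetaAdmissibleWeights
import HarnessLib

/-!
# S2β · (SCT″-c)₁ — «THE c₁ LETTER, DISCHARGED AT FIXED STATION DATA»: ✓p840244 `c1Budget_of_bkg_letters_volR` with every BOOKKEEPING letter discharged by name —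
# the weights (✓p840245 `exists_admissible_weights_v2`, WEIGHT LINE v2 of record: `w 1 = 1`, `W := 7`), the sign
# `0 < C_B·α` (monotone weakening `C_B ↦ C_B + 1` of the (BKG) binder, so only `0 < α` is asked), and the junction row COLLAPSED to its `i = 0` term (forced once the
# weights are discharged: `E_J(w)` sees `w` only through `w 1 = 1`) — leaving displayed ONLY the analytic letters and the WINDOWS (kept free on purpose, RULING «FB-σ»:
# window constants last — `Mbar` multiplies the S′-feedback coefficient `2·256·Cst·Mbar²·C_cov`, which the station must take SMALL, so it is NOT frozen at `1∕4`):
# (T) `Mg`∕`hMg`∕`hMg4` + `Mbar`∕`hM0`∕`hM1`∕`hM`, (BKG) + ONE smallness at `C_B + 1`, the second-order remainder `R`∕`hR` with its row profile `hRa`∕`ha`: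
# `Σ_{t<K−J} L^t·c₁(t) ≤ 2·(2·Cst·C₅)·(4·L⁻¹·(L^{K−J}·REL) + 7·(12d²Γ²(2(C_B+1)α)²·S′∕L + 192·d²·A²·S′∕L + 3·L^{K−J−2}·Σ_{μ,ν,y′} junction₀(X)²)) + 2·(256·Cst·Mbar²·C_cov)·S′`

Cell `ym3-torus` (YM ladder rung R3 = continuum `SU(2)` Yang–Mills on the three-torus at fixed lattice data — a RUNG: NOT d = 4, NOT infinite volume, NOT a mass gap,
NOT Clay).  Width seat `ym-ust-20520-w4` (gen 29); crux `stmt-QuantumFields-20520`, LINE g18-1 S2β; piece (d) (desk №718 preference, architect px17 g23 2026-09-01T02:41:42Z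
(c) concur: «it discharges `Mg`∕`Mbar`∕`0 < C_Bα`∕weights by name» — `Mbar` deliberately KEPT free, see above).  `--kind proof --supports stmt-QuantumFields-20520 --as helper`, count-neutral, DEFINITION-FREE
(0 `def`, 0 `instance`, 0 `notation`, 0 `sorry`, default heartbeats; hb-100k twin rc 0 after splitting the junction collapse into its own lemma).

WHAT IS PROVED (sorry-free; composition BY NAME + one Finset collapse).  ★`junctionRow_le_of_weightOne (X) (w) (hw1 : w 1 = 1)`: ✓p839415's third summand (generic
weights, without its factor `3`) `≤ L^{K−J−2}·Σ_{μ,ν}Σ_{y′ : Site (F.P K) (0+1)} junction₀(X)²` (`Finset.sum_ite_eq'`; equality when `1 ≤ K − J`).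
★★★`c1Budget_discharged`: hypotheses = `hJK Cst hCst U₀ ζ X hXdef Mg hMg hMg4 (C_B α) (hCB : 0 ≤ C_B) (hα : 0 < α) hBKG (h24∕hSU at (C_B+1)·α) R hR0 hR a A hRa ha
Mbar hM0 hM1 hM` — i.e. ✓p840244's with `w hw W hW hwdom hpos` GONE; conclusion = ✓p838904's c₁ TEXT with `W := 7`, `Cθ := 2·(C_B+1)·α`, the R-row as
✓p840010's S′-share and the junction row collapsed. Proof: `exists_admissible_weights_v2` ⊕ (BKG)↦(BKG)_{C_B+1} ⊕ ✓p839707 `exists_srcClasses_of_bkg'` ⊕ ✓p839840 ⊕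
✓p840010 ⊕ ✓p839415 (`cornerM_*`, `Bsrc_split_le`) ⊕ ✓p838904.
WHY `C_B + 1`: `PlaqSmall` is strict and (BKG) is `≤`, so the class road needs `0 < C_B·α`; the station prefix fixes `C_B ≥ 0` before the constants, hence the knit
weakens (BKG) to `C_B + 1` itself and asks only `0 < α` (true at the prefix for `J < K`: `((5L)²∕4)·θ_i ≤ α`, `0 < θ`; the `J = K` corner is the consumer's `max α 0`
split, as in ✓p836413).  The ONE smallness is then asked at `(C_B+1)·α` — an `α ≤ α₀(L, C_B)` clause of the prefix.

DOMAIN LINE (plan (3) v4; architect px17 g23 02:00:25Z (S1)∕(S2), 02:25:49Z (W := 7), desk №130∕№718).  As ✓p840244: linear row and R-row are S′-shares BY KERNEL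
modulo `hRa`∕`ha` ⟸ (β-3)′ C₇a ∘ ratio profile ✓p839850∕(REG-UP)′ ✓p840162 ∘ size profiles row (REG-UP) C ∘ (RES-u) ∘ δ-class ✓p839707 ((O3), px12∕px13 lineage);
(T) ⟸ ✓p836413 `relChordChart_of_guard` at the station prefix (guard `s₀ ≤ 1∕128`); the junction term `L^{K−J−2}·Σ junction₀²` is (REG)-class at the Thm-2
representative (px21 (JNC-E) `junctionEnergy_le_purse`: `≤ 2304·c²·L⁻¹·purse` with `‖ζ‖ ≤ c·η`), `hThm2S3` at `L = 3`; (L2-TOWER)@rep STRUCK, the naked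
(L2-TOWER) refuted (✓`…L2TowerContractionFalse`∕✓p840124). [Balaban1985RegularSpaces] Thm 2 (1.36) p.83; [Balaban1985Averaging] (19)–(20) p.21, Prop. 3 (123),
Prop. 4 (128)–(135) pp.37–38; [Balaban1987RG1] (0.1)–(0.4), (0.11), (0.18) pp.251–255.

HONEST SCOPE.  Composition of landed letters plus elementary bookkeeping; nothing of Bałaban's renormalisation-group analysis is asserted or proved; (BKG), (T),
`R`∕`hRa`∕`ha`, the junction term's pricing, `REL`, `S′` are HYPOTHESES or others'; GAP♯∘ (`stub_uniformFibreGapOrbit`, registry 3732b7df UNTOUCHED, 0∕5), S2β, the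
five registered stubs, crux 20520, 19936, 19200 and `YM3TorusSU2` are NOT proved; no registered stub is closed; rung R3 — NOT d = 4, NOT infinite volume, NOT a mass gap,
NOT Clay; the Yang–Mills mass gap is NOT proved.
-/

set_option autoImplicit false

noncomputable section

open scoped Matrix.Norms.L2Operator
open Finset

namespace Summit.QuantumFields.YangMills.Theorems.FluctuationComparisonRegPrIntLS2BetaCurlBudgetDischarged

open Literature.MathematicalPhysics.QuantumFieldTheory.Balaban1983to89
open Literature.MathematicalPhysics.QuantumFieldTheory.Balaban1983to89.T4Continuum
open Literature.MathematicalPhysics.QuantumFieldTheory.Balaban1983to89.T3ContinuumYM3Torus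
open Literature.MathematicalPhysics.QuantumFieldTheory.Balaban1983to89.T3LevelShift
open Literature.MathematicalPhysics.QuantumFieldTheory.Balaban1983to89.T3TiltDescent
open Literature.MathematicalPhysics.QuantumFieldTheory.Balaban1983to89.T3UnitLawDensityEML (ℰp)
open Literature.MathematicalPhysics.QuantumFieldTheory.Balaban1983to89.T4HaarSU2ExpChart (expPoint)
open Literature.MathematicalPhysics.QuantumFieldTheory.Balaban1983to89.T4ExpWindowSmallField (logVec)
open Literature.MathematicalPhysics.QuantumFieldTheory.Balaban1983to89.HaarExponentialChart
open Literature.MathematicalPhysics.QuantumFieldTheory.Balaban1983to89.HaarExponentialChart.IsChartRep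
open Literature.MathematicalPhysics.QuantumFieldTheory.Balaban1983to89.BlockAveraging (Idx blockAvg avgFun loopHol)
open Literature.MathematicalPhysics.QuantumFieldTheory.Balaban1983to89.ExpMeanLog (expMeanLogSU deltaSU)
open Literature.MathematicalPhysics.QuantumFieldTheory.Balaban1983to89.BlockAveragingEMLLinearisedBackground (covWalkSum)
open Literature.MathematicalPhysics.QuantumFieldTheory.Balaban1983to89.B10Eq47AxialChi (shiftN)
open Literature.MathematicalPhysics.QuantumFieldTheory.Balaban1983to89.B14.Eq22Determines (blockIter)
open Literature.MathematicalPhysics.QuantumFieldTheory.Balaban1983to89.B10Eq27TorusAxialLog (rel)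
open Literature.MathematicalPhysics.QuantumFieldTheory.Balaban1983to89.B10Eq18SigmaSU2 (su2Coord)
open Literature.MathematicalPhysics.QuantumFieldTheory.Balaban1983to89.B10Eq18SigmaSU2Haar (rev)
open Literature.MathematicalPhysics.QuantumLattice (su2Quat)
open Summit.QuantumFields.YangMills.Theorems.FluctuationComparisonRegPrIntLS2BetaChartReadDescentOntoExpPoint (su2Coord_rev_mem_lie)
open Summit.QuantumFields.YangMills.Theorems.FluctuationComparisonRegPrIntLS2BetaCurlBudgetLetter (c1Budget_of_letters)
open Summit.QuantumFields.YangMills.Theorems.FluctuationComparisonRegPrIntLS2BetaSourceRowEnergySplit (Bsrc_split_le cornerM_nonneg cornerM_dominates cornerM_energy)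
open Summit.QuantumFields.YangMills.Theorems.FluctuationComparisonRegPrIntLS2BetaSourceClassesOfBkg (exists_srcClasses_of_bkg')
open Summit.QuantumFields.YangMills.Theorems.FluctuationComparisonRegPrIntLS2BetaSourceEnergyLinearShareOfVol (Elin_le_beta_Sprime)
open Summit.QuantumFields.YangMills.Theorems.FluctuationComparisonRegPrIntLS2BetaRowEnergyShareOfVol (ER_le_beta_Sprime)
open Summit.QuantumFields.YangMills.Theorems.FluctuationComparisonRegPrIntLS2BetaAdmissibleWeights (exists_admissible_weights_v2)

variable (F : T3Family)

/-- ★ **THE JUNCTION ROW COLLAPSES TO ITS `i = 0` TERM**: with `w 1 = 1` (WEIGHT LINE v2), ✓`Bsrc_split_le`'s third summand (without its factor `3`) is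
`≤ L^{K−J−2}·Σ_{μ,ν,y′} junction₀(X)²` — every `i ≠ 0` term vanishes (`(if i = 0 then … else 0)² = 0`), the `i = 0` term is it exactly when `1 ≤ K − J`, and the
right side is `≥ 0` when `K = J`. [cite: Balaban1985Averaging, Prop. 4 (128)-(135) pp.37-38] -/
theorem junctionRow_le_of_weightOne {J K : ℕ} (X : (i : ℕ) → PBond (F.P K) i → (specialUnitaryLogChart (Fin 2)).lie)
    (w : ℕ → ℝ) (hw1 : w 1 = 1) :
    ∑ i ∈ Finset.range (K - J), w (i + 1) * (F.L : ℝ) ^ (K - J - 1 - (i + 1)) *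
          ∑ μ : Fin (F.P K).d, ∑ ν : Fin (F.P K).d, ∑ y' : Site (F.P K) (i + 1),
            (if i = 0 then ((Fintype.card (Idx (F.P K)) : ℝ)⁻¹ *
            ∑ a ∈ (Finset.univ : Finset (Idx (F.P K))) ×ˢ (Finset.range (F.P K).L ×ˢ Finset.range (F.P K).L),
              (Real.exp (‖X i ⟨(shiftN (shiftN (Site.blockSite y' a.1.1) μ a.2.1) ν a.2.2), μ⟩‖ + ‖X i ⟨((shiftN (shiftN (Site.blockSite y' a.1.1) μ a.2.1) ν a.2.2)).shift μ, ν⟩‖ + ‖X i ⟨((shiftN (shiftN (Site.blockSite y' a.1.1) μ a.2.1) ν a.2.2)).shift ν, μ⟩‖ + ‖X i ⟨(shiftN (shiftN (Site.blockSite y' a.1.1) μ a.2.1) ν a.2.2), ν⟩‖) - 1 - (‖X i ⟨(shiftN (shiftN (Site.blockSite y' a.1.1) μ a.2.1) ν a.2.2), μ⟩‖ + ‖X i ⟨((shiftN (shiftN (Site.blockSite y' a.1.1) μ a.2.1) ν a.2.2)).shift μ, ν⟩‖ + ‖X i ⟨((shiftN (shiftN (Site.blockSite y' a.1.1) μ a.2.1)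 ν a.2.2)).shift ν, μ⟩‖ + ‖X i ⟨(shiftN (shiftN (Site.blockSite y' a.1.1) μ a.2.1) ν a.2.2), ν⟩‖))) else 0) ^ 2 ≤
      (F.L : ℝ) ^ (K - J - 2) *
          ∑ μ : Fin (F.P K).d, ∑ ν : Fin (F.P K).d, ∑ y' : Site (F.P K) (0 + 1),
            (((Fintype.card (Idx (F.P K)) : ℝ)⁻¹ *
            ∑ a ∈ (Finset.univ : Finset (Idx (F.P K))) ×ˢ (Finset.range (F.P K).L ×ˢ Finset.range (F.P K).L),
              (Real.exp (‖X 0 ⟨(shiftN (shiftN (Site.blockSite y' a.1.1) μ a.2.1) ν a.2.2), μ⟩‖ + ‖X 0 ⟨((shiftN (shiftN (Site.blockSite y' a.1.1) μ a.2.1) ν a.2.2)).shift μ, ν⟩‖ + ‖X 0 ⟨((shiftN (shiftN (Site.blockSite y' a.1.1) μ a.2.1) ν a.2.2)).shift ν, μ⟩‖ + ‖X 0 ⟨(shiftN (shiftN (Site.blockSite y' a.1.1) μ a.2.1) ν a.2.2), ν⟩‖) - 1 - (‖X 0 ⟨(shiftN (shiftN (Site.blockSite y' a.1.1) μ a.2.1)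 ν a.2.2), μ⟩‖ + ‖X 0 ⟨((shiftN (shiftN (Site.blockSite y' a.1.1) μ a.2.1) ν a.2.2)).shift μ, ν⟩‖ + ‖X 0 ⟨((shiftN (shiftN (Site.blockSite y' a.1.1) μ a.2.1) ν a.2.2)).shift ν, μ⟩‖ + ‖X 0 ⟨(shiftN (shiftN (Site.blockSite y' a.1.1) μ a.2.1) ν a.2.2), ν⟩‖)))) ^ 2 := by
  have hL0 : (0 : ℝ) ≤ (F.L : ℝ) := Nat.cast_nonneg _
  have hJ0 : 0 ≤ (F.L : ℝ) ^ (K - J - 2) *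
          ∑ μ : Fin (F.P K).d, ∑ ν : Fin (F.P K).d, ∑ y' : Site (F.P K) (0 + 1),
            (((Fintype.card (Idx (F.P K)) : ℝ)⁻¹ *
            ∑ a ∈ (Finset.univ : Finset (Idx (F.P K))) ×ˢ (Finset.range (F.P K).L ×ˢ Finset.range (F.P K).L),
              (Real.exp (‖X 0 ⟨(shiftN (shiftN (Site.blockSite y' a.1.1) μ a.2.1) ν a.2.2), μ⟩‖ + ‖X 0 ⟨((shiftN (shiftN (Site.blockSite y' a.1.1) μ a.2.1) ν a.2.2)).shift μ, ν⟩‖ + ‖X 0 ⟨((shiftN (shiftN (Site.blockSite y' a.1.1) μ a.2.1) ν a.2.2)).shift ν, μ⟩‖ + ‖X 0 ⟨(shiftN (shiftN (Site.blockSite y' a.1.1) μ a.2.1) ν a.2.2), ν⟩‖) - 1 - (‖X 0 ⟨(shiftN (shiftN (Site.blockSite y' a.1.1) μ a.2.1) ν a.2.2), μ⟩‖ + ‖X 0 ⟨((shiftN (shiftN (Site.blockSite y' a.1.1) μ a.2.1) ν a.2.2)).shift μ, ν⟩‖ + ‖X 0 ⟨((shiftN (shiftN (Site.blockSite y' a.1.1)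 μ a.2.1) ν a.2.2)).shift ν, μ⟩‖ + ‖X 0 ⟨(shiftN (shiftN (Site.blockSite y' a.1.1) μ a.2.1) ν a.2.2), ν⟩‖)))) ^ 2 :=
      mul_nonneg (pow_nonneg hL0 _) (Finset.sum_nonneg fun _ _ => Finset.sum_nonneg fun _ _ => Finset.sum_nonneg fun _ _ => sq_nonneg _)
  refine le_trans (Finset.sum_le_sum fun i hi => ?_) (le_trans (le_of_eq (Finset.sum_ite_eq' (Finset.range (K - J)) 0
      (fun _ => (F.L : ℝ) ^ (K - J - 2) *
          ∑ μ : Fin (F.P K).d, ∑ ν : Fin (F.P K).d, ∑ y' : Site (F.P K) (0 + 1),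
            (((Fintype.card (Idx (F.P K)) : ℝ)⁻¹ *
            ∑ a ∈ (Finset.univ : Finset (Idx (F.P K))) ×ˢ (Finset.range (F.P K).L ×ˢ Finset.range (F.P K).L),
              (Real.exp (‖X 0 ⟨(shiftN (shiftN (Site.blockSite y' a.1.1) μ a.2.1) ν a.2.2), μ⟩‖ + ‖X 0 ⟨((shiftN (shiftN (Site.blockSite y' a.1.1) μ a.2.1) ν a.2.2)).shift μ, ν⟩‖ + ‖X 0 ⟨((shiftN (shiftN (Site.blockSite y' a.1.1) μ a.2.1) ν a.2.2)).shift ν, μ⟩‖ + ‖X 0 ⟨(shiftN (shiftN (Site.blockSite y' a.1.1) μ a.2.1) ν a.2.2), ν⟩‖) - 1 - (‖X 0 ⟨(shiftN (shiftN (Site.blockSite y' a.1.1) μ a.2.1) ν a.2.2), μ⟩‖ + ‖X 0 ⟨((shiftN (shiftN (Site.blockSite y' a.1.1) μ a.2.1) ν a.2.2)).shift μ, ν⟩‖ + ‖X 0 ⟨((shiftN (shiftN (Site.blockSite y' a.1.1) μ a.2.1) ν a.2.2)).shift ν, μ⟩‖ + ‖X 0 ⟨(shiftN (shiftN (Site.blockSite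 y' a.1.1) μ a.2.1) ν a.2.2), ν⟩‖)))) ^ 2))) ?_)
  · by_cases hi0 : i = 0
    · subst hi0
      rw [if_pos rfl]
      have hw01 : w (0 + 1) = 1 := hw1
      have he : K - J - 1 - (0 + 1) = K - J - 2 := by omega
      rw [hw01, one_mul, he]
      refine mul_le_mul_of_nonneg_left (le_of_eq ?_) (pow_nonneg hL0 _)
      simp only [if_true]
    · rw [if_neg hi0]
      simp only [hi0, if_false, ne_eq, not_false_eq_true, zero_pow, OfNat.ofNat_ne_zero, Finset.sum_const_zero, mul_zero, le_refl]
  · split_ifs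
    · exact le_rfl
    · exact hJ0

/-- ★★★ **THE c₁ LETTER, DISCHARGED AT FIXED STATION DATA** — ✓`c1Budget_of_letters` ∘ ✓`Bsrc_split_le` (ℓ²-corner size) ∘ ✓`exists_srcClasses_of_bkg'` (at `C_B+1`)
∘ ✓`Elin_le_beta_Sprime` ∘ ✓`ER_le_beta_Sprime` ∘ ✓`exists_admissible_weights_v2` ∘ ✓`junctionRow_le_of_weightOne` (windows `Mg`, `Mbar` free); see the module header for the
ledger and the DOMAIN LINE. [cite: Balaban1985Averaging, (19)-(20) p.21, Prop. 3 (123), Prop. 4 (128)-(135) pp.37-38; Balaban1987RG1, (0.1)-(0.4), (0.11), (0.18) pp.251-255] -/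
theorem c1Budget_discharged {J K : ℕ} (hJK : J ≤ K) (Cst : ℝ) (hCst : 0 ≤ Cst)
    (U₀ : GaugeField (F.P K) 0 (Matrix.specialUnitaryGroup (Fin 2) ℂ)) (ζ : PBond (F.P K) 0 → EuclideanSpace ℝ (Fin 3))
    (X : (i : ℕ) → PBond (F.P K) i → (specialUnitaryLogChart (Fin 2)).lie)
    (hXdef : X = fun (i : ℕ) (b : PBond (F.P K) i) =>
      (⟨su2Coord (rev (logVec (su2Quat (Averaging.iter (fun k => BlockAveraging.blockAvg (P := F.P K) (j := k) ℰp) i (fun ℓ => expPoint (ζ ℓ) * U₀ ℓ : GaugeField (F.P K) 0 (Matrix.specialUnitaryGroup (Fin 2) ℂ)) b * (Averaging.iter (fun k => BlockAveraging.blockAvg (P := F.P K) (j := k) ℰp) i U₀ b)⁻¹)))), su2Coord_rev_mem_lie _⟩ : (specialUnitaryLogChart (Fin 2)).lie))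
    (Mg : ℕ → ℝ) (hMg : ∀ t, t ≤ K - J → ∀ b : PBond (F.P K) t,
      ‖logVec (su2Quat (Averaging.iter (fun k => BlockAveraging.blockAvg (P := F.P K) (j := k) ℰp) t (fun ℓ => expPoint (ζ ℓ) * U₀ ℓ : GaugeField (F.P K) 0 (Matrix.specialUnitaryGroup (Fin 2) ℂ)) b * (Averaging.iter (fun k => BlockAveraging.blockAvg (P := F.P K) (j := k) ℰp) t U₀ b)⁻¹))‖ ≤ Mg t)
    (hMg4 : ∀ t, t ≤ K - J → Mg t ≤ 1 / 4)
    (C_B α : ℝ) (hCB : 0 ≤ C_B) (hα : 0 < α)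
    (hBKG : ∀ t, t ≤ K - J → ∀ p : Plaq (F.P K) t,
      dist1 (GaugeField.plaqHol (Averaging.iter (fun k => BlockAveraging.blockAvg (P := F.P K) (j := k) ℰp) t U₀) p) ≤
        C_B * α * (F.L : ℝ) ^ (2 * t) * ((F.L : ℝ)⁻¹) ^ (2 * (K - J)))
    (h24 : ((((F.P K).d + 2) * (F.P K).L : ℕ) : ℝ) ^ 2 / 4 * ((C_B + 1) * α) ≤ 1 / 24)
    (hSU : ((((F.P K).d + 2) * (F.P K).L : ℕ) : ℝ) ^ 2 / 4 * ((C_B + 1) * α) < deltaSU (Fin 2))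
    (R : Fin (F.P K).d → Fin (F.P K).d → (i : ℕ) → Site (F.P K) i → ℝ) (hR0 : ∀ μ ν i x, 0 ≤ R μ ν i x)
    (hR : ∀ μ ν : Fin (F.P K).d, μ < ν → ∀ i, i < K - J → ∀ (y' : Site (F.P K) (i + 1)) (c : PBond (F.P K) (i + 1)),
      (c = ⟨y', μ⟩ ∨ c = ⟨y'.shift μ, ν⟩ ∨ c = ⟨y'.shift ν, μ⟩ ∨ c = ⟨y', ν⟩) →
      ‖(((isChartRep_specialUnitaryGroup (n := Fin 2)).logChart (avgFun (expMeanLogSU (n := Fin 2)) (fun b => (isChartRep_specialUnitaryGroup (n := Fin 2)).expChart (X i b) * Averaging.iter (fun k => BlockAveraging.blockAvg (P := F.P K) (j := k) ℰp) i U₀ b) c * (avgFun (expMeanLogSU (n := Fin 2)) (Averaging.iter (fun k => BlockAveraging.blockAvg (P := F.P K) (j := k) ℰp) i U₀) c)⁻¹) : (specialUnitaryLogChart (Fin 2)).lie) : Matrix (Fin 2) (Fin 2) ℂ) -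
        ((fderiv ℝ (fun (A : PBond (F.P K) i → (specialUnitaryLogChart (Fin 2)).lie) (c : PBond (F.P K) (i + 1)) => (isChartRep_specialUnitaryGroup (n := Fin 2)).logChart (avgFun (expMeanLogSU (n := Fin 2)) (fun b => (isChartRep_specialUnitaryGroup (n := Fin 2)).expChart (A b) * Averaging.iter (fun k => BlockAveraging.blockAvg (P := F.P K) (j := k) ℰp) i U₀ b) c * (avgFun (expMeanLogSU (n := Fin 2)) (Averaging.iter (fun k => BlockAveraging.blockAvg (P := F.P K) (j := k) ℰp) i U₀) c)⁻¹)) 0 (X i) c : (specialUnitaryLogChart (Fin 2)).lie) : Matrix (Fin 2) (Fin 2) ℂ)‖ ≤ R μ ν (i + 1) y')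
    (a : ℕ → ℝ) (A : ℝ)
    (hRa : ∀ (μ ν : Fin (F.P K).d) (i : ℕ), i < K - J → ∀ y' : Site (F.P K) (i + 1),
      R μ ν (i + 1) y' ^ 2 ≤ a (i + 1) ^ 2 * ∑ b ∈ univ.filter (fun b : PBond (F.P K) i =>
        blockOf b.src = y' ∨ blockOf b.src = y'.shift μ ∨ blockOf b.src = y'.shift ν ∨ blockOf b.src = (y'.shift μ).shift ν), ‖X i b‖ ^ 2)
    (ha : ∀ i, i < K - J → a (i + 1) ^ 2 ≤ A ^ 2 * ((F.L : ℝ) ^ (2 * i) / (F.L : ℝ) ^ (2 * (K - J))) ^ 2)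
    (Mbar : ℝ) (hM0 : 0 ≤ Mbar) (hM1 : 4 * Mbar ≤ 1)
    (hM : ∀ s, s < K - J → ∀ b : PBond (F.P K) s, ‖logVec (su2Quat (Averaging.iter (fun k => BlockAveraging.blockAvg (P := F.P K) (j := k) ℰp) s (fun ℓ => expPoint (ζ ℓ) * U₀ ℓ : GaugeField (F.P K) 0 (Matrix.specialUnitaryGroup (Fin 2) ℂ)) b * (Averaging.iter (fun k => BlockAveraging.blockAvg (P := F.P K) (j := k) ℰp) s U₀ b)⁻¹))‖ ≤ Mbar) :
    ∑ t ∈ Finset.range (K - J), (F.L : ℝ) ^ t * (fun t => Cst * ∑ B : PBond (F.P J) 0,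
      ‖(fun p : Plaq (F.P K) (K - J - 1 - t) =>
        if ∃ z₀ : Site (F.P K) 0, (blockIter (K - J) z₀ = (bondShift (F.sitesPerDir_eq (m := F.m) (K := J) (j := 0) (m' := F.m) (K' := K) (j' := K - J) (by omega)) B).src ∨
            blockIter (K - J) z₀ = (bondShift (F.sitesPerDir_eq (m := F.m) (K := J) (j := 0) (m' := F.m) (K' := K) (j' := K - J) (by omega)) B).tgt) ∧
            ∀ κ, (rel (blockIter (K - J - 1 - t) z₀) p.src κ).natAbs ≤ (2 * F.L + 1)
        then dist1 ((GaugeField.plaqHol (Averaging.iter (fun k => BlockAveraging.blockAvg (P := F.P K) (j := k) ℰp) (K - J - 1 - t) U₀) p)⁻¹ *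
          GaugeField.plaqHol (Averaging.iter (fun k => BlockAveraging.blockAvg (P := F.P K) (j := k) ℰp) (K - J - 1 - t)
            (fun ℓ => expPoint (ζ ℓ) * U₀ ℓ : GaugeField (F.P K) 0 (Matrix.specialUnitaryGroup (Fin 2) ℂ))) p)
        else 0)‖ ^ 2) t ≤
      2 * ((2 * Cst * (((5 ^ (F.P K).d : ℕ) : ℝ) ^ 2 * (((2 * ((2 * F.L + 1) + 2) + 1) ^ (F.P K).d * 6 : ℕ) : ℝ) *
              (2 * ((((F.P K).L ^ (F.P K).d : ℕ) : ℝ) - 1) / ((((F.P K).L ^ (F.P K).d : ℕ) : ℝ) - 3)))) * (4 * (F.L : ℝ)⁻¹ * ((F.L : ℝ) ^ (K - J) * ∑ p : Plaq (F.P K) 0,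
                  (1 - reTr ((GaugeField.plaqHol U₀ p)⁻¹ * GaugeField.plaqHol (fun ℓ => expPoint (ζ ℓ) * U₀ ℓ : GaugeField (F.P K) 0 (Matrix.specialUnitaryGroup (Fin 2) ℂ)) p))) + 7 *
      (12 * ((F.P K).d : ℝ) ^ 2 * (2 * ((F.P K).L : ℝ) ^ 2 * (3 * (F.P K).L + 2) + 2 * ((F.P K).L : ℝ) ^ 2 + (48 * (F.P K).L + 24 * ((((F.P K).d + 2) * (F.P K).L : ℕ) : ℝ) + 1616 * ((((F.P K).d + 2) * (F.P K).L : ℕ) : ℝ)) * (((((F.P K).d + 2) * (F.P K).L : ℕ) : ℝ) ^ 2 / 4) +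
        2 * ((((F.P K).d + 2) * (F.P K).L : ℕ) : ℝ) * ((F.L : ℝ) ^ 2)) ^ 2 * (2 * ((C_B + 1) * α)) ^ 2 *
        (∑ t ∈ Finset.range (K - J), (if ht : t < K - J then
          (F.L : ℝ) ^ t * ∑ B : PBond (F.P J) 0,
            ‖(fun ℓ' : PBond (F.P (J + (t + 1))) 0 =>
              if ∃ z : Site (F.P (J + (t + 1))) 0,
                (B14.Eq22Determines.blockIter (t + 1) z = (bondShift (F.sitesPerDir_eq (m := F.m) (K := J) (j := 0) (m' := F.m) (K' := J + (t + 1)) (j' := t + 1) (by omega)) B).src ∨ B14.Eq22Determines.blockIter (t + 1) z = (bondShift (F.sitesPerDir_eq (m := F.m) (K := J) (j := 0) (m' := F.m) (K' := J + (t + 1)) (j' := t + 1) (by omega)) B).tgt) ∧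
                ∀ ν, (B10Eq27TorusAxialLog.rel z ℓ'.src ν).natAbs ≤ 2
              then logVec (su2Quat (descendTo F ℰp (J + (t + 1)) K (by omega) (fun ℓ => expPoint (ζ ℓ) * U₀ ℓ : GaugeField (F.P K) 0 (Matrix.specialUnitaryGroup (Fin 2) ℂ)) ℓ' * (descendTo F ℰp (J + (t + 1)) K (by omega) U₀ ℓ')⁻¹)) else 0)‖ ^ 2
        else 0)) / (F.L : ℝ) +
      (192 * ((F.P K).d : ℝ) ^ 2 * A ^ 2 *
        (∑ t ∈ Finset.range (K - J), (if ht : t < K - J then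
          (F.L : ℝ) ^ t * ∑ B : PBond (F.P J) 0,
            ‖(fun ℓ' : PBond (F.P (J + (t + 1))) 0 =>
              if ∃ z : Site (F.P (J + (t + 1))) 0,
                (B14.Eq22Determines.blockIter (t + 1) z = (bondShift (F.sitesPerDir_eq (m := F.m) (K := J) (j := 0) (m' := F.m) (K' := J + (t + 1)) (j' := t + 1) (by omega)) B).src ∨ B14.Eq22Determines.blockIter (t + 1) z = (bondShift (F.sitesPerDir_eq (m := F.m) (K := J) (j := 0) (m' := F.m) (K' := J + (t + 1)) (j' := t + 1) (by omega)) B).tgt) ∧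
                ∀ ν, (B10Eq27TorusAxialLog.rel z ℓ'.src ν).natAbs ≤ 2
              then logVec (su2Quat (descendTo F ℰp (J + (t + 1)) K (by omega) (fun ℓ => expPoint (ζ ℓ) * U₀ ℓ : GaugeField (F.P K) 0 (Matrix.specialUnitaryGroup (Fin 2) ℂ)) ℓ' * (descendTo F ℰp (J + (t + 1)) K (by omega) U₀ ℓ')⁻¹)) else 0)‖ ^ 2
        else 0)) / (F.L : ℝ)) +
      3 * ((F.L : ℝ) ^ (K - J - 2) *
          ∑ μ : Fin (F.P K).d, ∑ ν : Fin (F.P K).d, ∑ y' : Site (F.P K) (0 + 1),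
            (((Fintype.card (Idx (F.P K)) : ℝ)⁻¹ *
            ∑ a ∈ (Finset.univ : Finset (Idx (F.P K))) ×ˢ (Finset.range (F.P K).L ×ˢ Finset.range (F.P K).L),
              (Real.exp (‖X 0 ⟨(shiftN (shiftN (Site.blockSite y' a.1.1) μ a.2.1) ν a.2.2), μ⟩‖ + ‖X 0 ⟨((shiftN (shiftN (Site.blockSite y' a.1.1) μ a.2.1) ν a.2.2)).shift μ, ν⟩‖ + ‖X 0 ⟨((shiftN (shiftN (Site.blockSite y' a.1.1) μ a.2.1) ν a.2.2)).shift ν, μ⟩‖ + ‖X 0 ⟨(shiftN (shiftN (Site.blockSite y' a.1.1) μ a.2.1) ν a.2.2), ν⟩‖) - 1 - (‖X 0 ⟨(shiftN (shiftN (Site.blockSite y' a.1.1) μ a.2.1) ν a.2.2), μ⟩‖ + ‖X 0 ⟨((shiftN (shiftN (Site.blockSite y' a.1.1) μ a.2.1) ν a.2.2)).shift μ, ν⟩‖ + ‖X 0 ⟨((shiftN (shiftN (Site.blockSite y' a.1.1) μ a.2.1) ν a.2.2)).shift ν, μ⟩‖ + ‖X 0 ⟨(shiftN (shiftN (Site.blockSite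 y' a.1.1) μ a.2.1) ν a.2.2), ν⟩‖)))) ^ 2)))) +
      2 * ((256 * Cst * Mbar ^ 2 * ((2 * (F.P J).d * (2 * 3 + 1) ^ (F.P J).d : ℕ) : ℝ)) * (∑ t ∈ Finset.range (K - J), (if ht : t < K - J then
          (F.L : ℝ) ^ t * ∑ B : PBond (F.P J) 0,
            ‖(fun ℓ' : PBond (F.P (J + (t + 1))) 0 =>
              if ∃ z : Site (F.P (J + (t + 1))) 0,
                (B14.Eq22Determines.blockIter (t + 1) z = (bondShift (F.sitesPerDir_eq (m := F.m) (K := J) (j := 0) (m' := F.m) (K' := J + (t + 1)) (j' := t + 1) (by omega)) B).src ∨ B14.Eq22Determines.blockIter (t + 1) z = (bondShift (F.sitesPerDir_eq (m := F.m) (K := J) (j := 0) (m' := F.m) (K' := J + (t + 1)) (j' := t + 1) (by omega)) B).tgt) ∧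
                ∀ ν, (B10Eq27TorusAxialLog.rel z ℓ'.src ν).natAbs ≤ 2
              then logVec (su2Quat (descendTo F ℰp (J + (t + 1)) K (by omega) (fun ℓ => expPoint (ζ ℓ) * U₀ ℓ : GaugeField (F.P K) 0 (Matrix.specialUnitaryGroup (Fin 2) ℂ)) ℓ' * (descendTo F ℰp (J + (t + 1)) K (by omega) U₀ ℓ')⁻¹)) else 0)‖ ^ 2
        else 0))) := by
  have hL2 : (2 : ℝ) ≤ (F.L : ℝ) := by exact_mod_cast F.hL.2
  have hL1 : (1 : ℝ) ≤ (F.L : ℝ) := by linarith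
  have hL0 : (0 : ℝ) ≤ (F.L : ℝ) := by linarith
  -- the weights: WEIGHT LINE v2 with the summable tail (✓p840245), `W := 7`
  obtain ⟨w, hw, hW, hwdom, hw1, _hwline⟩ := exists_admissible_weights_v2 (L := (F.L : ℝ)) hL2 (K - J)
  -- (BKG) with `C_B + 1` (monotone weakening) so that `0 < (C_B + 1)·α`
  have hCB1 : (0 : ℝ) ≤ C_B + 1 := by linarith
  have hpos : 0 < (C_B + 1) * α := by positivity
  have hBKG' : ∀ t, t ≤ K - J → ∀ p : Plaq (F.P K) t,
      dist1 (GaugeField.plaqHol (Averaging.iter (fun k => BlockAveraging.blockAvg (P := F.P K) (j := k) ℰp) t U₀) p) ≤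
        (C_B + 1) * α * (F.L : ℝ) ^ (2 * t) * ((F.L : ℝ)⁻¹) ^ (2 * (K - J)) := by
    intro t ht p
    refine (hBKG t ht p).trans ?_
    have h0 : 0 ≤ α * (F.L : ℝ) ^ (2 * t) * ((F.L : ℝ)⁻¹) ^ (2 * (K - J)) :=
      mul_nonneg (mul_nonneg hα.le (pow_nonneg hL0 _)) (pow_nonneg (inv_nonneg.2 hL0) _)
    have h1 : C_B * α * (F.L : ℝ) ^ (2 * t) * ((F.L : ℝ)⁻¹) ^ (2 * (K - J)) =
        C_B * (α * (F.L : ℝ) ^ (2 * t) * ((F.L : ℝ)⁻¹) ^ (2 * (K - J))) := by ring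
    have h2 : (C_B + 1) * α * (F.L : ℝ) ^ (2 * t) * ((F.L : ℝ)⁻¹) ^ (2 * (K - J)) =
        (C_B + 1) * (α * (F.L : ℝ) ^ (2 * t) * ((F.L : ℝ)⁻¹) ^ (2 * (K - J))) := by ring
    rw [h1, h2]
    exact mul_le_mul_of_nonneg_right (by linarith) h0
  -- the three classes, at `Cθ := 2·(C_B + 1)·α`
  obtain ⟨αc, δc, αpc, αpbc, h1, h2, h3, h4, h5, h6, h7, h8, h9, h10, h11, hδr, hαr, hαpr⟩ :=
    exists_srcClasses_of_bkg' F U₀ (C_B + 1) α hCB1 hα.le hpos hL1 hBKG' h24 hSU (2 * ((C_B + 1) * α)) le_rfl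
  have hV2 := Elin_le_beta_Sprime F hJK U₀ ζ X hXdef αc δc αpbc (2 * ((C_B + 1) * α))
    (((((F.P K).d + 2) * (F.P K).L : ℕ) : ℝ) ^ 2 / 4) ((F.L : ℝ) ^ 2) hδr hαr hαpr h9 h4 h11
  have hV4 := ER_le_beta_Sprime F hJK U₀ ζ X hXdef R a A hRa ha
  -- the ℓ²-corner size as an opaque size letter `M`
  obtain ⟨M, hM', hXM, hEM⟩ : ∃ M : Fin (F.P K).d → Fin (F.P K).d → (i : ℕ) → Site (F.P K) i → ℝ,
      (∀ μ ν i x, 0 ≤ M μ ν i x) ∧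
      (∀ μ ν : Fin (F.P K).d, μ < ν → ∀ i, i < K - J → ∀ (y' : Site (F.P K) (i + 1)) (b : PBond (F.P K) i),
      (blockOf b.src = y' ∨ blockOf b.src = y'.shift μ ∨ blockOf b.src = y'.shift ν ∨ blockOf b.src = (y'.shift μ).shift ν) → ‖X i b‖ ≤ M μ ν (i + 1) y') ∧
      (∀ i, i < K - J → ∑ μ : Fin (F.P K).d, ∑ ν : Fin (F.P K).d, ∑ y' : Site (F.P K) (i + 1), M μ ν (i + 1) y' ^ 2 ≤ 4 * ((F.P K).d : ℝ) ^ 2 * ∑ b : PBond (F.P K) i, ‖X i b‖ ^ 2) :=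
    ⟨_, cornerM_nonneg F X, cornerM_dominates F X, fun i _ => cornerM_energy F X i⟩
  refine c1Budget_of_letters F hJK Cst hCst U₀ ζ w hw 7 hW X hXdef Mg hMg hMg4 αc δc αpc h1 h2 h3 h4 h5 h6 h7 h8
    M hM' hXM R hR0 hR _ ?_ Mbar hM0 hM1 hM
  refine (Bsrc_split_le F X w hw αc δc αpc αpbc h4 h9 h7 h10 M
    (fun i => 4 * ((F.P K).d : ℝ) ^ 2 * ∑ b : PBond (F.P K) i, ‖X i b‖ ^ 2) hEM R).trans ?_
  refine add_le_add (add_le_add ?_ ?_) ?_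
  · -- linear row: weight monotonicity, then the volume-road share
    refine le_trans ?_ hV2
    refine mul_le_mul_of_nonneg_left (Finset.sum_le_sum fun i hi => ?_) (by norm_num)
    exact mul_le_mul_of_nonneg_right (mul_le_mul_of_nonneg_right (hwdom i (Finset.mem_range.1 hi)) (pow_nonneg hL0 _))
      (mul_nonneg (sq_nonneg _) (mul_nonneg (mul_nonneg (by norm_num) (sq_nonneg _)) (Finset.sum_nonneg fun _ _ => sq_nonneg _)))
  · -- R row: weight monotonicity, then (V4)
    refine le_trans ?_ hV4
    refine mul_le_mul_of_nonneg_left (Finset.sum_le_sum fun i hi => ?_) (by norm_num)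
    exact mul_le_mul_of_nonneg_right (mul_le_mul_of_nonneg_right (hwdom i (Finset.mem_range.1 hi)) (pow_nonneg hL0 _))
      (Finset.sum_nonneg fun _ _ => Finset.sum_nonneg fun _ _ => Finset.sum_nonneg fun _ _ => sq_nonneg _)
  · -- junction row: only `i = 0` survives; `w 1 = 1` (`junctionRow_le_of_weightOne`)
    exact mul_le_mul_of_nonneg_left (junctionRow_le_of_weightOne F X w hw1) (by norm_num)

end Summit.QuantumFields.YangMills.Theorems.FluctuationComparisonRegPrIntLS2BetaCurlBudgetDischarged

end
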